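import Summits.CriticalPhenomena.PercolationContinuityZ3.Theorems.PercNearOneGluingNoHeavyLowerTailCubicThreePointSections
import Summits.CriticalPhenomena.PercolationContinuityZ3.Theorems.PercNearOneGluingNoHeavyLowerTailCubicThreePointTerminalClosure
import Mathlib.Algebra.BigOperators.Group.Finset.Powerset
import Mathlib.Tactic.Ring
import Mathlib.Tactic.Linarith
import HarnessLib

/-!
# `NoHeavyLowerTail` (stmt-CriticalPhenomena-4575) — Gladkov's three-point inequality is FIBRE-POSITIVE:
# the two-copy profile (coupling) form `#{Q,T} ≥ Σ_{i<j} #{Uᵢ,Uⱼ}` for every graph, every forced set and every set of shared-out edges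

Support file (prover prim-sahi-p2, SAHI cell P2 "restricted C₃ via percolation structure"; `--supports stmt-CriticalPhenomena-4575`).  No definitions, no
named facts, no sorries.  Finitary calculus of `…CubicThreePointSections` (prim-ineq-prove-2): configurations `S` of open edges, forced edges `K`, reachability
`R K S`, the five three-point cells `evQ, evU₁ (ab|c), evU₂ (ac|b), evU₃ (bc|a), evT` with indicators `ind`; the quadratic form
`AG(q,u₁,u₂,u₃,t) = qt − e₂(u)` of `…CubicThreePointTerminalClosure` (Gladkov's strong Harris–Kleitman row, `prodBernoulli_threePoint_strongHarris`).

THE TWO-COPY COUPLING.  Fix terminals `a b c`, a forced set `K` ("edges open in both copies") and a finite set `P` of edges to be SHARED OUT: each `X ⊆ P` gives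
the pair of configurations (copy 1 = `K ∪ X`, copy 2 = `K ∪ (P ∖ X)`), all `2^|P|` pairs with equal weight.  This is the conditional law, given the PROFILE
(`k_e = #copies containing e ∈ {0,1,2}`), of two independent Bernoulli configurations with ANY weights — so a polynomial inequality in the weights holds
coefficientwise in the tensor-Bernstein basis of multi-degree 2 iff the corresponding pattern count is nonnegative in every such coupling.

THEOREM (`coupling_gladkov`).  In every coupling, the number of `X` for which one copy induces `a|b|c` and the other `abc` is at least the number of `X`
for which the two copies induce two DIFFERENT one-pair cells:
      `#{X : {π(K∪X), π(K∪(P∖X))} = {Q, T}}  ≥  Σ_{i<j} #{X : {π(K∪X), π(K∪(P∖X))} = {Uᵢ, Uⱼ}}`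
(stated with indicators and ordered pairs: `Σ_X [Q·T' + T·Q'] ≥ Σ_X Σ_{i≠j} Uᵢ·Uⱼ'`).  Equivalently: every multi-degree-2 tensor-Bernstein coefficient of
`x ↦ AG(law(x))` is `≥ 0` ("Gladkov's inequality is fibre-positive"); in particular it re-proves `AG ≥ 0` for all weights, but it is strictly stronger.
PROOF (= Gladkov's one-coordinate step, read pointwise).  `g(X,Y) := AG(δ(X)+δ(Y)) − AG(δ(X)) − AG(δ(Y))` (twice the polar form of `AG` at the two
indicator vectors) is exactly the signed pattern indicator `Q T' + T Q' − Σ_{i≠j} Uᵢ Uⱼ'` (`polar_eq_pattern`).  Shelling one shared edge `e`: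
`g(X+e, Y) + g(X, Y+e) = g(X,Y) + g⁺(X,Y) − [AG(d+d') − AG(d) − AG(d')]` where `g⁺` is `g` with `e` forced and `d, d'` are the TRANSITION vectors
`δ⁺ − δ` of the two configurations (`polar_shell`, a `ring` identity), and `−[AG(d+d') − AG(d) − AG(d')] ≥ 0` for every pair of monotone transitions
(`Q → Uᵢ`, `Q → T`, `Uᵢ → T`, or none: `transition_cases`, `polar_transition_nonneg` — Gladkov's `Γ ≥ 0`, tree `coordGamma_nonneg`, pointwise).  Summing over
`X ⊆ P ∖ e` and inducting on `|P|` with `K` arbitrary (`coupling_sum_nonneg`) gives the theorem; base `P = ∅`: `g(X,X) = 2·AG(δ) = 0` on a unit vector.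
USE.  This is the proved half of the fibre programme of run/shared/lean/prim/prim-sahi/prim-sahi-p2/PROOF-E3.md §7: the three-copy analogue for
`H_{q+t} = (q+t)AG − e₃` (Conjecture B⁺⁺, verified on every profile of every graph with ≤ 5 vertices) would give SHK3⁺ = Sahi's C₃ on the pairwise separations for all graphs.
[cite: Gladkov2024StrongFKG, Thm. 2.1 and Cor. 4.2 (the inequality AG ≥ 0 and its one-coordinate proof)]; [cite: GladkovZimin2024HK, §4–§5 (multi-copy couplings / switching)]
-/

noncomputable section

namespace Summit.CriticalPhenomena.PercolationContinuityZ3.Theorems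

namespace TerminalGluing

open Finset SimpleGraph Literature.Probability.Percolation Literature.Probability.Percolation.DecisionTree
open CubicThreePointStep CubicThreePointTerminal

variable {V : Type*} [DecidableEq V]

/-! ### The signed pattern of a pair of configurations, as the polar form of `AG` -/

section Polar

variable (K : Finset (Sym2 V)) (a b c : V)

/-- The polar form of `AG` at the indicator vectors of two configurations is the signed pattern indicator
`Q(X)T(Y) + T(X)Q(Y) − Σ_{i≠j} Uᵢ(X)Uⱼ(Y)`. [folklore] -/
theorem polar_eq_pattern (X Y : Finset (Sym2 V)) :
    AG (ind (evQ K a b c) X + ind (evQ K a b c) Y) (ind (evU₁ K a b c) X + ind (evU₁ K a b c) Y)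
        (ind (evU₂ K a b c) X + ind (evU₂ K a b c) Y) (ind (evU₃ K a b c) X + ind (evU₃ K a b c) Y)
        (ind (evT K a b c) X + ind (evT K a b c) Y)
      - AG (ind (evQ K a b c) X) (ind (evU₁ K a b c) X) (ind (evU₂ K a b c) X) (ind (evU₃ K a b c) X) (ind (evT K a b c) X)
      - AG (ind (evQ K a b c) Y) (ind (evU₁ K a b c) Y) (ind (evU₂ K a b c) Y) (ind (evU₃ K a b c) Y) (ind (evT K a b c) Y) =
    (ind (evQ K a b c) X * ind (evT K a b c) Y + ind (evT K a b c) X * ind (evQ K a b c) Y)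
      - (ind (evU₁ K a b c) X * ind (evU₂ K a b c) Y + ind (evU₂ K a b c) X * ind (evU₁ K a b c) Y
        + ind (evU₁ K a b c) X * ind (evU₃ K a b c) Y + ind (evU₃ K a b c) X * ind (evU₁ K a b c) Y
        + ind (evU₂ K a b c) X * ind (evU₃ K a b c) Y + ind (evU₃ K a b c) X * ind (evU₂ K a b c) Y) := by
  simp only [AG]; ring

end Polar

/-! ### Monotone transitions when one more edge is forced -/

section Transition

variable {K : Finset (Sym2 V)} {a b c : V} {e : Sym2 V}

/-- **The eight monotone transitions.**  Forcing one more edge `e` moves the cell of a configuration `X` along `Q → Uᵢ`, `Q → T`, `Uᵢ → T` or not at all: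
the transition vector `δ(K ∪ {e}, X) − δ(K, X)` of the five cell indicators is one of eight explicit vectors. [folklore] -/
theorem transition_cases (X : Finset (Sym2 V)) :
    (ind (evQ (insert e K) a b c) X - ind (evQ K a b c) X = 0 ∧ ind (evU₁ (insert e K) a b c) X - ind (evU₁ K a b c) X = 0 ∧
        ind (evU₂ (insert e K) a b c) X - ind (evU₂ K a b c) X = 0 ∧ ind (evU₃ (insert e K) a b c) X - ind (evU₃ K a b c) X = 0 ∧
        ind (evT (insert e K) a b c) X - ind (evT K a b c) X = 0) ∨
    (ind (evQ (insert e K) a b c) X - ind (evQ K a b c) X = -1 ∧ ind (evU₁ (insert e K) a b c) X - ind (evU₁ K a b c) X = 1 ∧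
        ind (evU₂ (insert e K) a b c) X - ind (evU₂ K a b c) X = 0 ∧ ind (evU₃ (insert e K) a b c) X - ind (evU₃ K a b c) X = 0 ∧
        ind (evT (insert e K) a b c) X - ind (evT K a b c) X = 0) ∨
    (ind (evQ (insert e K) a b c) X - ind (evQ K a b c) X = -1 ∧ ind (evU₁ (insert e K) a b c) X - ind (evU₁ K a b c) X = 0 ∧
        ind (evU₂ (insert e K) a b c) X - ind (evU₂ K a b c) X = 1 ∧ ind (evU₃ (insert e K) a b c) X - ind (evU₃ K a b c) X = 0 ∧
        ind (evT (insert e K) a b c) X - ind (evT K a b c) X = 0) ∨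
    (ind (evQ (insert e K) a b c) X - ind (evQ K a b c) X = -1 ∧ ind (evU₁ (insert e K) a b c) X - ind (evU₁ K a b c) X = 0 ∧
        ind (evU₂ (insert e K) a b c) X - ind (evU₂ K a b c) X = 0 ∧ ind (evU₃ (insert e K) a b c) X - ind (evU₃ K a b c) X = 1 ∧
        ind (evT (insert e K) a b c) X - ind (evT K a b c) X = 0) ∨
    (ind (evQ (insert e K) a b c) X - ind (evQ K a b c) X = -1 ∧ ind (evU₁ (insert e K) a b c) X - ind (evU₁ K a b c) X = 0 ∧
        ind (evU₂ (insert e K) a b c) X - ind (evU₂ K a b c) X = 0 ∧ ind (evU₃ (insert e K) a b c) X - ind (evU₃ K a b c) X = 0 ∧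
        ind (evT (insert e K) a b c) X - ind (evT K a b c) X = 1) ∨
    (ind (evQ (insert e K) a b c) X - ind (evQ K a b c) X = 0 ∧ ind (evU₁ (insert e K) a b c) X - ind (evU₁ K a b c) X = -1 ∧
        ind (evU₂ (insert e K) a b c) X - ind (evU₂ K a b c) X = 0 ∧ ind (evU₃ (insert e K) a b c) X - ind (evU₃ K a b c) X = 0 ∧
        ind (evT (insert e K) a b c) X - ind (evT K a b c) X = 1) ∨
    (ind (evQ (insert e K) a b c) X - ind (evQ K a b c) X = 0 ∧ ind (evU₁ (insert e K) a b c) X - ind (evU₁ K a b c) X = 0 ∧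
        ind (evU₂ (insert e K) a b c) X - ind (evU₂ K a b c) X = -1 ∧ ind (evU₃ (insert e K) a b c) X - ind (evU₃ K a b c) X = 0 ∧
        ind (evT (insert e K) a b c) X - ind (evT K a b c) X = 1) ∨
    (ind (evQ (insert e K) a b c) X - ind (evQ K a b c) X = 0 ∧ ind (evU₁ (insert e K) a b c) X - ind (evU₁ K a b c) X = 0 ∧
        ind (evU₂ (insert e K) a b c) X - ind (evU₂ K a b c) X = 0 ∧ ind (evU₃ (insert e K) a b c) X - ind (evU₃ K a b c) X = -1 ∧
        ind (evT (insert e K) a b c) X - ind (evT K a b c) X = 1) := by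
  -- the old and new connections; new ⊇ old
  have mab : R K X a b → R (insert e K) X a b := R_mono_insert e
  have mac : R K X a c → R (insert e K) X a c := R_mono_insert e
  have mbc : R K X b c → R (insert e K) X b c := R_mono_insert e
  by_cases hab : R K X a b <;> by_cases hac : R K X a c <;> by_cases hbc : R K X b c <;>
    by_cases hab' : R (insert e K) X a b <;> by_cases hac' : R (insert e K) X a c <;> by_cases hbc' : R (insert e K) X b c
  all_goals first
    | exact absurd (mab hab) hab'
    | exact absurd (mac hac) hac'
    | exact absurd (mbc hbc) hbc'
    | exact absurd (hab.trans hbc) hac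
    | exact absurd (hac.trans hbc.symm) hab
    | exact absurd (hab.symm.trans hac) hbc
    | exact absurd (hab'.trans hbc') hac'
    | exact absurd (hac'.trans hbc'.symm) hab'
    | exact absurd (hab'.symm.trans hac') hbc'
    | skip
  all_goals
    simp only [ind, mem_evQ, mem_evU₁, mem_evU₂, mem_evU₃, mem_evT, hab, hac, hbc, hab', hac', hbc', not_true_eq_false,
      not_false_eq_true, and_true, and_false, if_true, if_false]
    norm_num

/-- **Gladkov's `Γ ≥ 0`, pointwise**: for any two monotone transition vectors `d, d'` the polar form satisfies
`−[AG(d + d') − AG(d) − AG(d')] ≥ 0`. [cite: Gladkov2024StrongFKG, proof of Thm. 2.1 (the quadratic step)] -/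
theorem polar_transition_nonneg (X Y : Finset (Sym2 V)) :
    0 ≤ -(AG (ind (evQ (insert e K) a b c) X - ind (evQ K a b c) X + (ind (evQ (insert e K) a b c) Y - ind (evQ K a b c) Y))
            (ind (evU₁ (insert e K) a b c) X - ind (evU₁ K a b c) X + (ind (evU₁ (insert e K) a b c) Y - ind (evU₁ K a b c) Y))
            (ind (evU₂ (insert e K) a b c) X - ind (evU₂ K a b c) X + (ind (evU₂ (insert e K) a b c) Y - ind (evU₂ K a b c) Y))
            (ind (evU₃ (insert e K) a b c) X - ind (evU₃ K a b c) X + (ind (evU₃ (insert e K) a b c) Y - ind (evU₃ K a b c) Y))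
            (ind (evT (insert e K) a b c) X - ind (evT K a b c) X + (ind (evT (insert e K) a b c) Y - ind (evT K a b c) Y))
        - AG (ind (evQ (insert e K) a b c) X - ind (evQ K a b c) X) (ind (evU₁ (insert e K) a b c) X - ind (evU₁ K a b c) X)
            (ind (evU₂ (insert e K) a b c) X - ind (evU₂ K a b c) X) (ind (evU₃ (insert e K) a b c) X - ind (evU₃ K a b c) X)
            (ind (evT (insert e K) a b c) X - ind (evT K a b c) X)
        - AG (ind (evQ (insert e K) a b c) Y - ind (evQ K a b c) Y) (ind (evU₁ (insert e K) a b c) Y - ind (evU₁ K a b c) Y)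
            (ind (evU₂ (insert e K) a b c) Y - ind (evU₂ K a b c) Y) (ind (evU₃ (insert e K) a b c) Y - ind (evU₃ K a b c) Y)
            (ind (evT (insert e K) a b c) Y - ind (evT K a b c) Y)) := by
  have hX := transition_cases (K := K) (a := a) (b := b) (c := c) (e := e) X
  have hY := transition_cases (K := K) (a := a) (b := b) (c := c) (e := e) Y
  generalize ind (evQ (insert e K) a b c) X - ind (evQ K a b c) X = xq at hX ⊢
  generalize ind (evU₁ (insert e K) a b c) X - ind (evU₁ K a b c) X = x₁ at hX ⊢
  generalize ind (evU₂ (insert e K) a b c) X - ind (evU₂ K a b c) X = x₂ at hX ⊢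
  generalize ind (evU₃ (insert e K) a b c) X - ind (evU₃ K a b c) X = x₃ at hX ⊢
  generalize ind (evT (insert e K) a b c) X - ind (evT K a b c) X = xt at hX ⊢
  generalize ind (evQ (insert e K) a b c) Y - ind (evQ K a b c) Y = yq at hY ⊢
  generalize ind (evU₁ (insert e K) a b c) Y - ind (evU₁ K a b c) Y = y₁ at hY ⊢
  generalize ind (evU₂ (insert e K) a b c) Y - ind (evU₂ K a b c) Y = y₂ at hY ⊢
  generalize ind (evU₃ (insert e K) a b c) Y - ind (evU₃ K a b c) Y = y₃ at hY ⊢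
  generalize ind (evT (insert e K) a b c) Y - ind (evT K a b c) Y = yt at hY ⊢
  simp only [AG]
  rcases hX with ⟨rfl, rfl, rfl, rfl, rfl⟩ | ⟨rfl, rfl, rfl, rfl, rfl⟩ | ⟨rfl, rfl, rfl, rfl, rfl⟩ | ⟨rfl, rfl, rfl, rfl, rfl⟩ |
      ⟨rfl, rfl, rfl, rfl, rfl⟩ | ⟨rfl, rfl, rfl, rfl, rfl⟩ | ⟨rfl, rfl, rfl, rfl, rfl⟩ | ⟨rfl, rfl, rfl, rfl, rfl⟩ <;>
    rcases hY with ⟨rfl, rfl, rfl, rfl, rfl⟩ | ⟨rfl, rfl, rfl, rfl, rfl⟩ | ⟨rfl, rfl, rfl, rfl, rfl⟩ | ⟨rfl, rfl, rfl, rfl, rfl⟩ |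
      ⟨rfl, rfl, rfl, rfl, rfl⟩ | ⟨rfl, rfl, rfl, rfl, rfl⟩ | ⟨rfl, rfl, rfl, rfl, rfl⟩ | ⟨rfl, rfl, rfl, rfl, rfl⟩ <;>
    norm_num

/-- **The shelling identity** (pointwise form of Gladkov's chord identity `AG_coord_chord`): for the polar form
`g_K(X,Y) = AG(δ_K X + δ_K Y) − AG(δ_K X) − AG(δ_K Y)`,
`g_K(X+e, Y) + g_K(X, Y+e) = g_K(X,Y) + g_{K+e}(X,Y) − [AG(d_X + d_Y) − AG(d_X) − AG(d_Y)]`, `d = δ_{K+e} − δ_K`; here with `X+e` read through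
`δ_K(X ∪ {e}) = δ_{K ∪ {e}}(X)`. [folklore] -/
theorem polar_shell (q₀ a₀ b₀ c₀ t₀ q₁ a₁ b₁ c₁ t₁ Q₀ A₀ B₀ C₀ T₀ Q₁ A₁ B₁ C₁ T₁ : ℝ) :
    (AG (q₁ + Q₀) (a₁ + A₀) (b₁ + B₀) (c₁ + C₀) (t₁ + T₀) - AG q₁ a₁ b₁ c₁ t₁ - AG Q₀ A₀ B₀ C₀ T₀)
      + (AG (q₀ + Q₁) (a₀ + A₁) (b₀ + B₁) (c₀ + C₁) (t₀ + T₁) - AG q₀ a₀ b₀ c₀ t₀ - AG Q₁ A₁ B₁ C₁ T₁) =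
    (AG (q₀ + Q₀) (a₀ + A₀) (b₀ + B₀) (c₀ + C₀) (t₀ + T₀) - AG q₀ a₀ b₀ c₀ t₀ - AG Q₀ A₀ B₀ C₀ T₀)
      + (AG (q₁ + Q₁) (a₁ + A₁) (b₁ + B₁) (c₁ + C₁) (t₁ + T₁) - AG q₁ a₁ b₁ c₁ t₁ - AG Q₁ A₁ B₁ C₁ T₁)
      - (AG (q₁ - q₀ + (Q₁ - Q₀)) (a₁ - a₀ + (A₁ - A₀)) (b₁ - b₀ + (B₁ - B₀)) (c₁ - c₀ + (C₁ - C₀)) (t₁ - t₀ + (T₁ - T₀))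
          - AG (q₁ - q₀) (a₁ - a₀) (b₁ - b₀) (c₁ - c₀) (t₁ - t₀) - AG (Q₁ - Q₀) (A₁ - A₀) (B₁ - B₀) (C₁ - C₀) (T₁ - T₀)) := by
  simp only [AG]; ring

end Transition

/-! ### The coupling sum and the induction on the shared-out edges -/

section Coupling

variable (a b c : V)

/-- Opening an edge of the configuration is forcing it (cell `a|b|c`). [folklore] -/
theorem ind_evQ_insert (K X : Finset (Sym2 V)) (e : Sym2 V) :
    ind (evQ K a b c) (insert e X) = ind (evQ (insert e K) a b c) X := by
  have h := sect_evQ K a b c e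
  rw [Set.ext_iff] at h
  by_cases hm : X ∈ evQ (insert e K) a b c
  · rw [ind_of_mem hm, ind_of_mem (show insert e X ∈ evQ K a b c from (h X).2 hm)]
  · rw [ind_of_not_mem hm, ind_of_not_mem (show insert e X ∉ evQ K a b c from fun h' => hm ((h X).1 h'))]

/-- Opening an edge of the configuration is forcing it (cell `ab|c`). [folklore] -/
theorem ind_evU₁_insert (K X : Finset (Sym2 V)) (e : Sym2 V) :
    ind (evU₁ K a b c) (insert e X) = ind (evU₁ (insert e K) a b c) X := by
  have h := sect_evU₁ K a b c e
  rw [Set.ext_iff] at h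
  by_cases hm : X ∈ evU₁ (insert e K) a b c
  · rw [ind_of_mem hm, ind_of_mem (show insert e X ∈ evU₁ K a b c from (h X).2 hm)]
  · rw [ind_of_not_mem hm, ind_of_not_mem (show insert e X ∉ evU₁ K a b c from fun h' => hm ((h X).1 h'))]

/-- Opening an edge of the configuration is forcing it (cell `ac|b`). [folklore] -/
theorem ind_evU₂_insert (K X : Finset (Sym2 V)) (e : Sym2 V) :
    ind (evU₂ K a b c) (insert e X) = ind (evU₂ (insert e K) a b c) X := by
  have h := sect_evU₂ K a b c e
  rw [Set.ext_iff] at h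
  by_cases hm : X ∈ evU₂ (insert e K) a b c
  · rw [ind_of_mem hm, ind_of_mem (show insert e X ∈ evU₂ K a b c from (h X).2 hm)]
  · rw [ind_of_not_mem hm, ind_of_not_mem (show insert e X ∉ evU₂ K a b c from fun h' => hm ((h X).1 h'))]

/-- Opening an edge of the configuration is forcing it (cell `bc|a`). [folklore] -/
theorem ind_evU₃_insert (K X : Finset (Sym2 V)) (e : Sym2 V) :
    ind (evU₃ K a b c) (insert e X) = ind (evU₃ (insert e K) a b c) X := by
  have h := sect_evU₃ K a b c e
  rw [Set.ext_iff] at h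
  by_cases hm : X ∈ evU₃ (insert e K) a b c
  · rw [ind_of_mem hm, ind_of_mem (show insert e X ∈ evU₃ K a b c from (h X).2 hm)]
  · rw [ind_of_not_mem hm, ind_of_not_mem (show insert e X ∉ evU₃ K a b c from fun h' => hm ((h X).1 h'))]

/-- Opening an edge of the configuration is forcing it (cell `abc`). [folklore] -/
theorem ind_evT_insert (K X : Finset (Sym2 V)) (e : Sym2 V) :
    ind (evT K a b c) (insert e X) = ind (evT (insert e K) a b c) X := by
  have h := sect_evT K a b c e
  rw [Set.ext_iff] at h
  by_cases hm : X ∈ evT (insert e K) a b c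
  · rw [ind_of_mem hm, ind_of_mem (show insert e X ∈ evT K a b c from (h X).2 hm)]
  · rw [ind_of_not_mem hm, ind_of_not_mem (show insert e X ∉ evT K a b c from fun h' => hm ((h X).1 h'))]

/-- Distinct cells are disjoint: the mixed products of the cell indicators of ONE configuration vanish. [folklore] -/
theorem ind_cells_mixed_zero (K X : Finset (Sym2 V)) :
    ind (evQ K a b c) X * ind (evT K a b c) X = 0 ∧ ind (evU₁ K a b c) X * ind (evU₂ K a b c) X = 0 ∧
      ind (evU₁ K a b c) X * ind (evU₃ K a b c) X = 0 ∧ ind (evU₂ K a b c) X * ind (evU₃ K a b c) X = 0 := by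
  refine ⟨?_, ?_, ?_, ?_⟩
  · by_cases h : X ∈ evQ K a b c
    · rw [ind_of_not_mem (fun h' : X ∈ evT K a b c => h.1 h'.1), mul_zero]
    · rw [ind_of_not_mem h, zero_mul]
  · by_cases h : X ∈ evU₁ K a b c
    · rw [ind_of_not_mem (fun h' : X ∈ evU₂ K a b c => h'.2 h.1), mul_zero]
    · rw [ind_of_not_mem h, zero_mul]
  · by_cases h : X ∈ evU₁ K a b c
    · rw [ind_of_not_mem (fun h' : X ∈ evU₃ K a b c => h'.2 h.1), mul_zero]
    · rw [ind_of_not_mem h, zero_mul]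
  · by_cases h : X ∈ evU₂ K a b c
    · rw [ind_of_not_mem (fun h' : X ∈ evU₃ K a b c => h.2 (h'.1 |> fun hbc => ?_)), mul_zero]
      exact (h.1.trans hbc.symm)
    · rw [ind_of_not_mem h, zero_mul]

/-- **The coupling sum of the polar form is nonnegative**: for every forced set `K` and every set `P` of shared-out edges,
`Σ_{X ⊆ P} [AG(δ_K X + δ_K(P∖X)) − AG(δ_K X) − AG(δ_K(P∖X))] ≥ 0` (induction on `P`, `K` arbitrary). [cite: Gladkov2024StrongFKG, Thm. 2.1 (fibrewise reading of the proof)] -/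
theorem coupling_sum_nonneg (P : Finset (Sym2 V)) : ∀ K : Finset (Sym2 V),
    0 ≤ ∑ X ∈ P.powerset,
      (AG (ind (evQ K a b c) X + ind (evQ K a b c) (P \ X)) (ind (evU₁ K a b c) X + ind (evU₁ K a b c) (P \ X))
          (ind (evU₂ K a b c) X + ind (evU₂ K a b c) (P \ X)) (ind (evU₃ K a b c) X + ind (evU₃ K a b c) (P \ X))
          (ind (evT K a b c) X + ind (evT K a b c) (P \ X))
        - AG (ind (evQ K a b c) X) (ind (evU₁ K a b c) X) (ind (evU₂ K a b c) X) (ind (evU₃ K a b c) X) (ind (evT K a b c) X)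
        - AG (ind (evQ K a b c) (P \ X)) (ind (evU₁ K a b c) (P \ X)) (ind (evU₂ K a b c) (P \ X)) (ind (evU₃ K a b c) (P \ X))
            (ind (evT K a b c) (P \ X))) := by
  induction P using Finset.induction_on with
  | empty =>
    intro K
    rw [Finset.powerset_empty, Finset.sum_singleton, Finset.sdiff_self]
    -- both copies are the same configuration `∅`: the polar form is `2·AG(unit vector) = 0`
    rw [polar_eq_pattern]
    obtain ⟨h1, h2, h3, h4⟩ := ind_cells_mixed_zero a b c K (∅ : Finset (Sym2 V))
    nlinarith [h1, h2, h3, h4, mul_comm (ind (evQ K a b c) ∅) (ind (evT K a b c) ∅),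
      mul_comm (ind (evU₁ K a b c) ∅) (ind (evU₂ K a b c) ∅), mul_comm (ind (evU₁ K a b c) ∅) (ind (evU₃ K a b c) ∅),
      mul_comm (ind (evU₂ K a b c) ∅) (ind (evU₃ K a b c) ∅)]
  | @insert e P heP ih =>
    intro K
    rw [Finset.sum_powerset_insert heP]
    have hsd1 : ∀ X ∈ P.powerset, insert e P \ X = insert e (P \ X) := fun X hX =>
      Finset.insert_sdiff_of_notMem P (fun h => heP (Finset.mem_powerset.1 hX h))
    have hsd2 : ∀ X ∈ P.powerset, insert e P \ insert e X = P \ X := fun X _ => by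
      rw [Finset.insert_sdiff_insert, Finset.sdiff_insert_of_notMem heP]
    have h0 := ih K
    have h1 := ih (insert e K)
    -- pointwise: shell identity + Γ ≥ 0
    have key : ∀ X ∈ P.powerset,
        (AG (ind (evQ K a b c) X + ind (evQ K a b c) (P \ X)) (ind (evU₁ K a b c) X + ind (evU₁ K a b c) (P \ X))
            (ind (evU₂ K a b c) X + ind (evU₂ K a b c) (P \ X)) (ind (evU₃ K a b c) X + ind (evU₃ K a b c) (P \ X))
            (ind (evT K a b c) X + ind (evT K a b c) (P \ X))
          - AG (ind (evQ K a b c) X) (ind (evU₁ K a b c) X) (ind (evU₂ K a b c) X) (ind (evU₃ K a b c) X) (ind (evT K a b c) X)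
          - AG (ind (evQ K a b c) (P \ X)) (ind (evU₁ K a b c) (P \ X)) (ind (evU₂ K a b c) (P \ X)) (ind (evU₃ K a b c) (P \ X))
              (ind (evT K a b c) (P \ X)))
        + (AG (ind (evQ (insert e K) a b c) X + ind (evQ (insert e K) a b c) (P \ X))
              (ind (evU₁ (insert e K) a b c) X + ind (evU₁ (insert e K) a b c) (P \ X))
              (ind (evU₂ (insert e K) a b c) X + ind (evU₂ (insert e K) a b c) (P \ X))
              (ind (evU₃ (insert e K) a b c) X + ind (evU₃ (insert e K) a b c) (P \ X))
              (ind (evT (insert e K) a b c) X + ind (evT (insert e K) a b c) (P \ X))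
          - AG (ind (evQ (insert e K) a b c) X) (ind (evU₁ (insert e K) a b c) X) (ind (evU₂ (insert e K) a b c) X)
              (ind (evU₃ (insert e K) a b c) X) (ind (evT (insert e K) a b c) X)
          - AG (ind (evQ (insert e K) a b c) (P \ X)) (ind (evU₁ (insert e K) a b c) (P \ X)) (ind (evU₂ (insert e K) a b c) (P \ X))
              (ind (evU₃ (insert e K) a b c) (P \ X)) (ind (evT (insert e K) a b c) (P \ X))) ≤
        (AG (ind (evQ K a b c) X + ind (evQ K a b c) (insert e P \ X)) (ind (evU₁ K a b c) X + ind (evU₁ K a b c) (insert e P \ X))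
            (ind (evU₂ K a b c) X + ind (evU₂ K a b c) (insert e P \ X)) (ind (evU₃ K a b c) X + ind (evU₃ K a b c) (insert e P \ X))
            (ind (evT K a b c) X + ind (evT K a b c) (insert e P \ X))
          - AG (ind (evQ K a b c) X) (ind (evU₁ K a b c) X) (ind (evU₂ K a b c) X) (ind (evU₃ K a b c) X) (ind (evT K a b c) X)
          - AG (ind (evQ K a b c) (insert e P \ X)) (ind (evU₁ K a b c) (insert e P \ X)) (ind (evU₂ K a b c) (insert e P \ X))
              (ind (evU₃ K a b c) (insert e P \ X)) (ind (evT K a b c) (insert e P \ X)))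
        + (AG (ind (evQ K a b c) (insert e X) + ind (evQ K a b c) (insert e P \ insert e X))
              (ind (evU₁ K a b c) (insert e X) + ind (evU₁ K a b c) (insert e P \ insert e X))
              (ind (evU₂ K a b c) (insert e X) + ind (evU₂ K a b c) (insert e P \ insert e X))
              (ind (evU₃ K a b c) (insert e X) + ind (evU₃ K a b c) (insert e P \ insert e X))
              (ind (evT K a b c) (insert e X) + ind (evT K a b c) (insert e P \ insert e X))
          - AG (ind (evQ K a b c) (insert e X)) (ind (evU₁ K a b c) (insert e X)) (ind (evU₂ K a b c) (insert e X))
              (ind (evU₃ K a b c) (insert e X)) (ind (evT K a b c) (insert e X))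
          - AG (ind (evQ K a b c) (insert e P \ insert e X)) (ind (evU₁ K a b c) (insert e P \ insert e X))
              (ind (evU₂ K a b c) (insert e P \ insert e X)) (ind (evU₃ K a b c) (insert e P \ insert e X))
              (ind (evT K a b c) (insert e P \ insert e X))) := by
      intro X hX
      rw [hsd1 X hX, hsd2 X hX]
      simp only [ind_evQ_insert, ind_evU₁_insert, ind_evU₂_insert, ind_evU₃_insert, ind_evT_insert]
      have hsh := polar_shell (ind (evQ K a b c) X) (ind (evU₁ K a b c) X) (ind (evU₂ K a b c) X) (ind (evU₃ K a b c) X) (ind (evT K a b c) X)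
        (ind (evQ (insert e K) a b c) X) (ind (evU₁ (insert e K) a b c) X) (ind (evU₂ (insert e K) a b c) X) (ind (evU₃ (insert e K) a b c) X)
        (ind (evT (insert e K) a b c) X)
        (ind (evQ K a b c) (P \ X)) (ind (evU₁ K a b c) (P \ X)) (ind (evU₂ K a b c) (P \ X)) (ind (evU₃ K a b c) (P \ X)) (ind (evT K a b c) (P \ X))
        (ind (evQ (insert e K) a b c) (P \ X)) (ind (evU₁ (insert e K) a b c) (P \ X)) (ind (evU₂ (insert e K) a b c) (P \ X))
        (ind (evU₃ (insert e K) a b c) (P \ X)) (ind (evT (insert e K) a b c) (P \ X))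
      have hΓ := polar_transition_nonneg (K := K) (a := a) (b := b) (c := c) (e := e) X (P \ X)
      linarith
    have hsum := Finset.sum_le_sum key
    rw [Finset.sum_add_distrib, Finset.sum_add_distrib] at hsum
    linarith

/-- **Fibre form of Gladkov's inequality (pattern-count statement).**  In the two-copy coupling over the shared-out set `P` with forced set `K`:
`Σ_{X ⊆ P} [ Q(X)T(P∖X) + T(X)Q(P∖X) − Σ_{i≠j} Uᵢ(X)Uⱼ(P∖X) ] ≥ 0`, i.e. `#{Q,T} ≥ Σ_{i<j} #{Uᵢ,Uⱼ}`: one copy all-separated with the other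
all-joined is at least as frequent as the two copies showing two different one-pair cells. [cite: Gladkov2024StrongFKG, Thm. 2.1 / Cor. 4.2 (fibrewise)] -/
theorem coupling_gladkov (K P : Finset (Sym2 V)) :
    0 ≤ ∑ X ∈ P.powerset,
      ((ind (evQ K a b c) X * ind (evT K a b c) (P \ X) + ind (evT K a b c) X * ind (evQ K a b c) (P \ X))
        - (ind (evU₁ K a b c) X * ind (evU₂ K a b c) (P \ X) + ind (evU₂ K a b c) X * ind (evU₁ K a b c) (P \ X)
          + ind (evU₁ K a b c) X * ind (evU₃ K a b c) (P \ X) + ind (evU₃ K a b c) X * ind (evU₁ K a b c) (P \ X)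
          + ind (evU₂ K a b c) X * ind (evU₃ K a b c) (P \ X) + ind (evU₃ K a b c) X * ind (evU₂ K a b c) (P \ X))) := by
  have h := coupling_sum_nonneg a b c P K
  rw [Finset.sum_congr rfl (fun X _ => polar_eq_pattern K a b c X (P \ X))] at h
  exact h

end Coupling

end TerminalGluing

end Summit.CriticalPhenomena.PercolationContinuityZ3.Theorems
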